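import Mathlib
import Summits.ResolutionOfSingularities.ResolutionOfSingularities.Theorems.CleanModels.Negative.CossartPiltant2019Thm15iFrameOrdTowerCurveChart
import HarnessLib

/-!
# Towards `CurveBlowupFacts 5`: the maximal ideal of a curve blow-up and the order of its regular parameters

Support file (INPUTS seat res-inputs-p-cp15frame g2, 2026-08-28) for the residual hypothesis `CurveBlowupFacts 5` of
`CossartPiltant2019_thm_1_5_i_frame_false_of_curveBlowupFacts` (RETIRED statement F-110, crux `CleanModels`,
stmt-ResolutionOfSingularities-15917).  For a regular system of parameters `x = (u₀, v, w)` of `R = range (S → K)` and the curve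
blow-up `B♯ = R[v/u₀]_{centre}` along `O = ord_𝔪` (`…OrdTowerCurveChart`):

* `OrdWitness.exists_pair_of_coeff_mem` — a polynomial `f ∈ 𝔪_R[T]` splits as `f(θ) = u₀·A(θ) + w·G(θ)` (`v = u₀θ`);
* `OrdWitness.maximalIdeal_Bsharp_eq_span` — **`𝔪_{B♯} = (u₀, w)`**;
* `OrdWitness.coeff_mem_of_ordVK_pair_le` — TWO-TERM QUASI-REGULARITY: `ord (u₀ A(θ) + w G(θ)) ≥ 2 ⟹ A, G ∈ 𝔪_R[T]`
  (the form `X₀·homog A + X₂·homog G` of degree `M+1` lies in `𝔪^{M+2}`; its monomials are distinct);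
* `OrdWitness.mem_sq_of_ordVK_le_expNeg_two` — an element of `B♯` of order `≥ 2` lies in `𝔪_{B♯}²`, whence
  **CurveBlowupFacts (a)**: `OrdWitness.ordVK_eq_expNeg_one_of_mem_maximalIdeal_Bsharp` — every `t ∈ 𝔪_{B♯} ∖ 𝔪_{B♯}²` has order
  exactly `1`.

Nothing here proves or refutes resolution of singularities in characteristic `p`; [OURS · NEGATIVE-SUPPORT] counted 0.
-/

noncomputable section

set_option linter.dupNamespace false -- mandated namespace of this single-conjunct summit

open MvPolynomial IsLocalRing
open Literature.AlgebraicGeometry.Resolution Literature.AlgebraicGeometry.Resolution.WeightedBlowup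

namespace Summit.ResolutionOfSingularities.ResolutionOfSingularities.Theorems.CleanModels.Negative

namespace OrdWitness

variable {p : ℕ} [hp : Fact p.Prime]
variable {x : Fin 3 → Rg p} (hx : Ideal.span (Set.range x) = maximalIdeal (Rg p))

/-! ## 1. `𝔪_{B♯} = (u₀, w)` -/

/-- The parameters `xᵢ` as elements of `B♯`. [folklore] -/
def xB (x : Fin 3 → Rg p) (i : Fin 3) : Bsharp p x := ⟨x i, range_le_Bsharp (x i).2⟩

/-- `xB i = xᵢ` in `K`. [folklore] -/
theorem coe_xB (i : Fin 3) : ((xB x i : Bsharp p x) : K p) = x i := rfl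

include hx in
/-- The parameters lie in `𝔪_{B♯}`. [folklore] -/
theorem xB_mem_maximalIdeal [IsLocalRing (Bsharp p x)] (i : Fin 3) : xB x i ∈ maximalIdeal (Bsharp p x) := by
  rw [mem_maximalIdeal_Bsharp_iff hx, coe_xB, ordVK_rsop hx i, expNeg_lt_one_iff]
  exact one_pos

include hx in
/-- **Splitting off `u₀` and `w`**: if every coefficient of `f` lies in `𝔪_R = (u₀, v, w)` then
`f(θ) = u₀ · A(θ) + w · G(θ)` for some `A, G ∈ R[T]` (write `fᵢ = αᵢu₀ + βᵢv + γᵢw` and use `v = u₀θ`). [folklore] -/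
theorem exists_pair_of_coeff_mem {f : Polynomial (Rg p)} (h : ∀ i, f.coeff i ∈ maximalIdeal (Rg p)) :
    ∃ A G : Polynomial (Rg p), Polynomial.aeval (theta p x) f =
      (x 0 : K p) * Polynomial.aeval (theta p x) A + (x 2 : K p) * Polynomial.aeval (theta p x) G := by
  classical
  have hc : ∀ i, ∃ c : Fin 3 → Rg p, ∑ j, c j * x j = f.coeff i := fun i =>
    Ideal.mem_span_range_iff_exists_fun.mp (hx.symm ▸ h i)
  choose c hc using hc
  set n := f.natDegree + 1 with hn
  refine ⟨∑ i ∈ Finset.range n, (Polynomial.C (c i 0) * Polynomial.X ^ i + Polynomial.C (c i 1) * Polynomial.X ^ (i + 1)),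
    ∑ i ∈ Finset.range n, Polynomial.C (c i 2) * Polynomial.X ^ i, ?_⟩
  have key : ∀ i, (f.coeff i : K p) = (c i 0 : K p) * x 0 + (c i 1 : K p) * x 1 + (c i 2 : K p) * x 2 := by
    intro i
    have := congrArg (fun t : Rg p => (t : K p)) (hc i)
    simp only [Fin.sum_univ_three, Subring.coe_add, Subring.coe_mul] at this
    exact this.symm
  have hx1 := coe_rsop_one_eq hx
  rw [Polynomial.aeval_eq_sum_range' (Nat.lt_succ_self _) (theta p x), map_sum, map_sum, Finset.mul_sum, Finset.mul_sum,
    ← Finset.sum_add_distrib]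
  refine Finset.sum_congr rfl fun i _ => ?_
  simp only [map_add, map_mul, Polynomial.aeval_C, map_pow, Polynomial.aeval_X, Algebra.smul_def]
  change (f.coeff i : K p) * theta p x ^ i = (x 0 : K p) * ((c i 0 : K p) * theta p x ^ i + (c i 1 : K p) * theta p x ^ (i + 1)) +
    (x 2 : K p) * ((c i 2 : K p) * theta p x ^ i)
  rw [key i, hx1]
  ring

include hx in
/-- **`𝔪_{B♯} = (u₀, w)`.**  An element `t = y/z ∈ 𝔪_{B♯}` has `y = f(θ)` of positive order, so `f ∈ 𝔪_R[T]` by quasi-regularity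
and `y = u₀A(θ) + wG(θ)`. [folklore] -/
theorem maximalIdeal_Bsharp_eq_span [IsLocalRing (Bsharp p x)] :
    maximalIdeal (Bsharp p x) = Ideal.span {xB x 0, xB x 2} := by
  have hequiv := Valuation.isEquiv_valuation_valuationSubring (ordVK p)
  apply le_antisymm
  · intro t ht
    have hlt := (mem_maximalIdeal_Bsharp_iff hx t).mp ht
    obtain ⟨y, hy, z, hz, hvz, hte⟩ := t.2
    obtain ⟨f, rfl⟩ := exists_aeval_of_mem_chart hy
    have hz1 : ordVK p z = 1 := hequiv.eq_one_iff_eq_one.mpr hvz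
    have hz0 : z ≠ 0 := ne_zero_of_valuation_eq_one hvz
    have hylt : ordVK p (Polynomial.aeval (theta p x) f) < 1 := by
      have : ordVK p (t : K p) = ordVK p (Polynomial.aeval (theta p x) f) := by rw [hte, map_div₀, hz1, div_one]
      rwa [← this]
    obtain ⟨A, G, hAG⟩ := exists_pair_of_coeff_mem hx (coeff_mem_maximalIdeal_of_ordVK_aeval_lt_one hx hylt)
    have ha : Polynomial.aeval (theta p x) A / z ∈ Bsharp p x := ⟨_, aeval_mem_chart A, z, hz, hvz, rfl⟩
    have hg : Polynomial.aeval (theta p x) G / z ∈ Bsharp p x := ⟨_, aeval_mem_chart G, z, hz, hvz, rfl⟩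
    refine Ideal.mem_span_pair.mpr ⟨⟨_, ha⟩, ⟨_, hg⟩, Subtype.ext ?_⟩
    show Polynomial.aeval (theta p x) A / z * (x 0 : K p) + Polynomial.aeval (theta p x) G / z * (x 2 : K p) = (t : K p)
    rw [hte, hAG]
    field_simp
  · rw [Ideal.span_le]
    rintro _ (rfl | rfl)
    · exact xB_mem_maximalIdeal hx 0
    · exact xB_mem_maximalIdeal hx 2

/-! ## 2. Two-term quasi-regularity and CurveBlowupFacts (a) -/

include hx in
/-- **Two-term quasi-regularity**: `ord (u₀·A(θ) + w·G(θ)) ≥ 2` forces every coefficient of `A` and of `G` into `𝔪_R`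
(the form `homog A · X₀ + homog G · X₂` of degree `M+1` evaluates into `𝔪^{M+2}`; Matsumura 17.10; its monomials are pairwise
distinct). [folklore] -/
theorem coeff_mem_of_ordVK_pair_le {A G : Polynomial (Rg p)}
    (h : ordVK p ((x 0 : K p) * Polynomial.aeval (theta p x) A + (x 2 : K p) * Polynomial.aeval (theta p x) G) ≤ expNeg 2) :
    (∀ i, A.coeff i ∈ maximalIdeal (Rg p)) ∧ (∀ i, G.coeff i ∈ maximalIdeal (Rg p)) := by
  classical
  set M := max A.natDegree G.natDegree with hM
  have hA : A.natDegree ≤ M := le_max_left _ _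
  have hG : G.natDegree ≤ M := le_max_right _ _
  set F : MvPolynomial (Fin 3) (Rg p) := homog M A * X 0 + homog M G * X 2 with hF
  have hFh : F.IsHomogeneous (M + 1) :=
    ((isHomogeneous_homog M A).mul (isHomogeneous_X _ 0)).add ((isHomogeneous_homog M G).mul (isHomogeneous_X _ 2))
  have hFeval : ((eval x F : Rg p) : K p) =
      (x 0 : K p) ^ M * ((x 0 : K p) * Polynomial.aeval (theta p x) A + (x 2 : K p) * Polynomial.aeval (theta p x) G) := by
    rw [hF, map_add, map_mul, map_mul, eval_X, eval_X, Subring.coe_add, Subring.coe_mul, Subring.coe_mul,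
      coe_eval_homog hx hA, coe_eval_homog hx hG]
    ring
  have hFmem : eval x F ∈ maximalIdeal (Rg p) ^ (M + 1 + 1) := by
    apply mem_pow_of_ordVK_le_expNeg
    rw [hFeval, map_mul, map_pow, ordVK_rsop hx 0, expNeg_one_pow, add_assoc, expNeg_add]
    exact mul_le_mul' le_rfl h
  have hall := coeff_mem_maximalIdeal_of_eval_mem_pow (spanFinrank_maximalIdeal_range p) x hx hFh hFmem
  constructor
  · intro j
    by_cases hj : j ≤ M
    · have := hall (expo M j + Finsupp.single 0 1)
      rw [hF, coeff_add, coeff_mul_X', coeff_mul_X', if_pos (by simp), if_neg (by simp [expo_two]), add_zero,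
        add_tsub_cancel_right, coeff_homog hj] at this
      exact this
    · rw [Polynomial.coeff_eq_zero_of_natDegree_lt (by omega)]; exact zero_mem _
  · intro j
    by_cases hj : j ≤ M
    · have := hall (expo M j + Finsupp.single 2 1)
      rw [hF, coeff_add, coeff_mul_X', coeff_mul_X', if_pos (show (2 : Fin 3) ∈ _ by simp), add_tsub_cancel_right,
        coeff_homog hj] at this
      have h0 : (if (0 : Fin 3) ∈ (expo M j + Finsupp.single 2 1).support then
          coeff (expo M j + Finsupp.single 2 1 - Finsupp.single 0 1) (homog M A) else 0) = 0 := by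
        split_ifs
        · apply coeff_homog_eq_zero
          simp [expo_two]
        · rfl
      rw [h0, zero_add] at this
      exact this
    · rw [Polynomial.coeff_eq_zero_of_natDegree_lt (by omega)]; exact zero_mem _

omit hp in
/-- Discreteness: a value `> exp (−2)` is `≥ exp (−1)`. [folklore] -/
theorem expNeg_one_le_of_not_le_expNeg_two {v : WithZero (Multiplicative ℤ)} (h : ¬ v ≤ expNeg 2) : expNeg 1 ≤ v := by
  have hv : v ≠ 0 := by rintro rfl; exact h zero_le
  obtain ⟨z, rfl⟩ := WithZero.ne_zero_iff_exists.mp hv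
  rw [expNeg, WithZero.coe_le_coe, ← Multiplicative.toAdd_le, toAdd_ofAdd] at h ⊢
  push_cast at h ⊢
  omega

include hx in
/-- **An element of `B♯` of order `≥ 2` lies in `𝔪_{B♯}²`**: `t = f(θ)/z`, `f ∈ 𝔪_R[T]`, `f(θ) = u₀A(θ) + wG(θ)` with
`A, G ∈ 𝔪_R[T]` by two-term quasi-regularity, so `t = u₀·(A(θ)/z) + w·(G(θ)/z)` with all four factors in `𝔪_{B♯}`. [folklore] -/
theorem mem_sq_of_ordVK_le_expNeg_two [IsLocalRing (Bsharp p x)] {t : Bsharp p x} (ht : ordVK p (t : K p) ≤ expNeg 2) :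
    t ∈ maximalIdeal (Bsharp p x) ^ 2 := by
  have hequiv := Valuation.isEquiv_valuation_valuationSubring (ordVK p)
  obtain ⟨y, hy, z, hz, hvz, hte⟩ := t.2
  obtain ⟨f, rfl⟩ := exists_aeval_of_mem_chart hy
  have hz1 : ordVK p z = 1 := hequiv.eq_one_iff_eq_one.mpr hvz
  have hz0 : z ≠ 0 := ne_zero_of_valuation_eq_one hvz
  have hyv : ordVK p (Polynomial.aeval (theta p x) f) = ordVK p (t : K p) := by rw [hte, map_div₀, hz1, div_one]
  have hylt : ordVK p (Polynomial.aeval (theta p x) f) < 1 := by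
    rw [hyv]; exact lt_of_le_of_lt ht (expNeg_lt_one_iff.mpr two_pos)
  obtain ⟨A, G, hAG⟩ := exists_pair_of_coeff_mem hx (coeff_mem_maximalIdeal_of_ordVK_aeval_lt_one hx hylt)
  obtain ⟨hAm, hGm⟩ := coeff_mem_of_ordVK_pair_le hx (x := x) (by rw [← hAG, hyv]; exact ht)
  have ha : Polynomial.aeval (theta p x) A / z ∈ Bsharp p x := ⟨_, aeval_mem_chart A, z, hz, hvz, rfl⟩
  have hg : Polynomial.aeval (theta p x) G / z ∈ Bsharp p x := ⟨_, aeval_mem_chart G, z, hz, hvz, rfl⟩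
  have ham : (⟨_, ha⟩ : Bsharp p x) ∈ maximalIdeal (Bsharp p x) := by
    rw [mem_maximalIdeal_Bsharp_iff hx]
    show ordVK p (Polynomial.aeval (theta p x) A / z) < 1
    rw [map_div₀, hz1, div_one]
    exact ordVK_aeval_lt_one_of_coeff_mem hx hAm
  have hgm : (⟨_, hg⟩ : Bsharp p x) ∈ maximalIdeal (Bsharp p x) := by
    rw [mem_maximalIdeal_Bsharp_iff hx]
    show ordVK p (Polynomial.aeval (theta p x) G / z) < 1
    rw [map_div₀, hz1, div_one]
    exact ordVK_aeval_lt_one_of_coeff_mem hx hGm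
  have e : t = xB x 0 * ⟨_, ha⟩ + xB x 2 * ⟨_, hg⟩ := by
    apply Subtype.ext
    show (t : K p) = (x 0 : K p) * (Polynomial.aeval (theta p x) A / z) + (x 2 : K p) * (Polynomial.aeval (theta p x) G / z)
    rw [hte, hAG]
    field_simp
  rw [e, pow_two]
  exact Ideal.add_mem _ (Ideal.mul_mem_mul (xB_mem_maximalIdeal hx 0) ham) (Ideal.mul_mem_mul (xB_mem_maximalIdeal hx 2) hgm)

include hx in
/-- **CurveBlowupFacts (a) for `B♯`**: every `t ∈ 𝔪_{B♯} ∖ 𝔪_{B♯}²` has `ordVK t = exp (−1)`. [folklore] -/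
theorem ordVK_eq_expNeg_one_of_mem_maximalIdeal_Bsharp [IsLocalRing (Bsharp p x)] (t : Bsharp p x)
    (ht : t ∈ maximalIdeal (Bsharp p x)) (ht2 : t ∉ maximalIdeal (Bsharp p x) ^ 2) : ordVK p (t : K p) = expNeg 1 := by
  have hlt := (mem_maximalIdeal_Bsharp_iff hx t).mp ht
  have hge : expNeg 1 ≤ ordVK p (t : K p) :=
    expNeg_one_le_of_not_le_expNeg_two fun hle => ht2 (mem_sq_of_ordVK_le_expNeg_two hx hle)
  exact eq_expNeg_one_of_le_of_lt hge hlt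

end OrdWitness

end Summit.ResolutionOfSingularities.ResolutionOfSingularities.Theorems.CleanModels.Negative

end
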